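import Summits.AtomisticToContinuum.FouriersLaw.Theorems.BondHeatUncertaintySubdiffusiveBondHeatJunctionGradedCalibration

/-!
# Relative locality: the door into `AsymptoticSeriesLaw`, and the Dini threshold on the relative junction axis

SPLIT (lean/CONVENTIONS.md §32, ≤ 400 lines per Theorems file; critic row 802; lens-1 gen 60).  This is PART (a) of the gen-59 file (15):
§A below, byte-for-byte the gen-59 text.  PART (b) — §B the Dini threshold (`DiniSeriesLaw`, `boundedResponse_of_diniSeriesLaw`) — is
`…JunctionRatioDini` (imports tree (12) only, like this file; the two parts are independent of each other).  The rest of this docstring is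
file (15)'s, unchanged; «this file» below means parts (a)+(b) together.

Support file for stmt-AtomisticToContinuum-11071 (`BondHeatUncertainty.BoundedResponse` ⟺ `OhmicFloor`: `E_N(T) ≤ C₁/N`), decomposition
cell `decomp-a2c`, lens-1 (grading / quantitative ladder), gen 59 — file (15) (imports tree (12) `…JunctionGradedCalibration` ONLY; it is
INDEPENDENT of files (13) `…JunctionRatioLadder` / (14) `…JunctionRatioCalibration`, whose Props it restates only in UNFOLDED form in
the conclusions of its theorems, so that it can land before or after them; the by-name frames over (13) are file (16)
`…JunctionRatioLocalityFrames`).  Conjunct of record N_F = `FouriersLaw` (residual 11071 ∧ 9121).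

THE BLOCKER.  The node of record for 11071 (critic row 785) is `11071 ⟸ [ASL] AsymptoticSeriesLaw ∧ [SOB] SubOhmicBootstrap`, both pieces
Fourier-NECESSARY.  [SOB] has doors (`BufferedJunctionLaw` ⟸ `LocalityPassivityLaw`; `NoAnomalousChannel`); [ASL] — the statement
`∀ ρ < 1, ∃ L₀ N₂, ∀ u v ≥ N₂, ρ·(r_u + r_v) ≤ r_{u+L₀+v}` for the escape resistance `r_N = 1/E_N(T)` — had NONE: «IDEA-NEEDED: an
additivity/locality theorem for the bulk resistance = RELATIVE locality».  This file types that door and prices the axis it lives on.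

§A THE DOOR (profile level ⟹ resistance level).  `RelativeBlockLawAt … ρ L₀`: in every steady state of the composite chain `u + L₀ + v` at
`(T ± δ/2)`, to first order in `δ`, each END block carries a kinetic-temperature drop at least `ρ·(E_N/E_block)·δ` — in ratio form, the
in-situ resistance of an embedded block is at least `ρ` times its free two-bath resistance `r_block` (a bulk resistivity exists up to the
factor `ρ`; arbitrary `o(r_block)` contact corrections allowed, where file (4)'s `EmbeddedBlockLawAt … c` allows `O(1)`).  With file (5)'s
SOFT partner `BufferPassivityAt … b L₀` (first-order temperature RISE across the buffer at most `b·E_N·δ`) the three drops telescope: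
  `RelativeBlockLawAt ρ ∧ BufferPassivityAt b ⟹ ρ·(r_u + r_v) − b ≤ r_{u+L₀+v}`            (`ratioJunctionAt_of_relativeProfileAt`),
and ONE GOOD SCALE absorbs the budget: if `liminf_N E_N(T) = 0` (the per-`T` instance of `EscapeInfZero` ≡ `NonBallistic`, stmt-9127,
itself FL- and ASL-necessary), then for every `ρ' < ρ` the pure ratio law `ρ'·(r_u + r_v) ≤ r_{u+L₀+v}` holds beyond a larger threshold
(`ratioJunctionAt_absorb`: past one scale `u⋆` with `ρ·r_{u⋆} ≥ b·(…)`, every longer chain has `r ≥ b/(ρ − ρ')`).  Hence the node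
  `[ASL] ⟸ [RLL<1] (∀ ρ < 1, RelativeLocalityLaw ρ) ∧ [EIZ] EscapeInfZero`                    (`asymptoticSeries_of_relativeLocality_of_escapeInfZero`),
per rung `RelativeLocalityLaw ρ ∧ EscapeInfZero ⟹ SeriesRatioLaw ρ'` (`ρ' < ρ`), with `RelativeLocalityLaw ρ := ∀ …, ∃ b L₀, RelativeBlockLawAt
… ρ L₀ ∧ BufferPassivityAt … b L₀`.  GRADING AND CALIBRATION of the door: antitone in `ρ` (`relativeLocalityLaw_anti`); WEAKER than file (5)'s
absolute door for every `ρ < 1` — `LocalityPassivityLaw ∧ EscapeVanishing ⟹ RelativeLocalityLaw ρ` (`…_of_localityPassivityLaw_of_escapeVanishing`;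
`EscapeVanishing` ≡ 28286 is ASL-necessary); at the HARMONIC member (Rieder–Lebowitz–Lieb: flat bulk profile at the mean temperature, each
contact carries half the imposed difference, `E_N → e_∞ > 0`) the analogue of `RelativeBlockLawAt ρ` is TRUE for `ρ < 1/2` and FALSE for
`ρ > 1/2` — the same threshold `1/2` at which the resistance-level ladder `SeriesRatioLaw ρ` stops being phonon-true (bounded `r`), so the
door is correctly calibrated: its content above `ρ = 1/2` is exactly «anharmonic pinning destroys the ballistic profile plateau».  [EIZ] is the
piece that fails for phonons.  Even `ρ = 0` has content at profile level (no first-order overshoot of the end-site kinetic temperatures past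
the bath temperatures) — unlike `SeriesRatioLaw 0`, which is proved.

§B THE DINI THRESHOLD (pure sequence analysis + census dictionary).  On the relative axis the necessary side is «slack → 0»
(`AsymptoticSeriesLaw`; not sufficient: `r_N = N/log N`, file (14)) and the sufficient side so far started at «slack = 0» (`SeriesRatioLaw 1` ⟺
`BufferedSeriesLaw`).  The exact price in between is a DINI CONDITION: `DiniSeriesLaw` — slack `ε(min u v)` with `ε ≥ 0` antitone and
`Σ_n ε(n)/n < ∞` (⟺ `Σ_k ε(2^k) < ∞`) — is SUFFICIENT for 11071 with NO floor partner (`boundedResponse_of_diniSeriesLaw`, kernel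
`linear_of_diniRatio`: along the doubling chain `r_{N_j} ≥ 2^j·∏(1 − ε) ≥ (3/4)·2^j` once the dyadic tail of `ε` is `< 1/4`), it implies
`∀ ρ < 1, SeriesRatioLaw ρ` (`seriesRatio_of_diniSeriesLaw`), and it sits BELOW every absolute door of files (3)–(13):
`BufferedSeriesLaw ⟹ DiniSeriesLaw` (`ε ≡ 0`) and `BufferedJunctionLaw ∧ ExponentFloor s ⟹ DiniSeriesLaw` for any `s > 0` (`ε(n) ≍ n^{−s}`;
hence also below `SeriesRatioLaw ρ ∧ BufferedJunctionLaw`, `ρ > 1/2`, via file (13)'s exponent dictionary).  The slack `1/log N` of the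
`N/log N` witness is the textbook non-Dini modulus: the census question «is `1 − r_{u+L₀+v}/(r_u + r_v)` summable over dyadic scales?» is
the sharp form of «does the ratio tend to one fast enough».  This is the multiplicative counterpart of the de Bruijn–Erdős relaxed
subadditivity lemma (`a_{m+n} ≤ a_m + a_n + φ(m+n)` with `∫ φ(t) t^{-2} dt < ∞` still gives `lim a_n/n`; Steele, *Probability Theory and
Combinatorial Optimization*, SIAM 1997, Lemma 1.9.1 (the range `n/2 ≤ m ≤ 2n` suffices) and Thm 1.9.2).  NOT FL-necessary as typed (an
eventually-monotone slack is an artefact: `r_N = N` off the scales `4^j` with `r_{4^j} = 4^j·(1 + 1/j)` is Fourier-like with best slack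
`≍ 1/j` at `N = 4^j`, not summable) — it is a THRESHOLD rung, not a piece of the conjecture.

TAGS (lens-1 convention).  `RelativeBlockLawAt`/`RelativeLocalityLaw ρ`: UNDECIDED · IDEA-NEEDED (no locality estimate for first-order NESS
profiles of the anharmonic pinned chain, in tree or in print) · INSTRUMENTABLE (NESS profile fractions `φ(i) = (T_L − ⟨p_i²⟩)/δ` of the
composite cell: `φ(u−1)·E_u/E_N ≥ ρ` and `(1 − φ(u+L₀))·E_v/E_N ≥ ρ`; prediction `↑ 1⁻` in the cell size, kill sign: bounded away below `1`;
phonon value `1/2`) · MECHANISM-LEVEL (a profile statement: neither implied by nor implying 11071 at sequence level; everything it yields on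
`r_N` factors through `SeriesRatioLaw ρ'`, `ρ' < ρ`, consistent with `N/log N`) · WEAKER than `LocalityPassivityLaw` given `EscapeVanishing`.
`EscapeInfZero`: WEAKER (FL- and ASL-necessary; ≡ open item 9127).  `DiniSeriesLaw`: UNDECIDED · SUFFICIENT for 11071 · WEAKER than
`BufferedSeriesLaw` and than `BufferedJunctionLaw ∧ ExponentFloor s` (`s > 0`) · not FL-necessary · INSTRUMENTABLE (fit of `1 − ratio`
against `1/log N` vs `N^{−s}` on the `E_N(T)` table).  No `sorry`; standard axioms; nothing here closes an item.

Contents.  §A `RelativeBlockLawAt`, `RatioJunctionAt`, the seam, monotonicity, absorption, the dictionary with `EmbeddedBlockLawAt`,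
`RelativeLocalityLaw`, the door theorems (conclusions in the unfolded shape of `SeriesRatioLaw`/`AsymptoticSeriesLaw` of file (13));
§B `pow_mul_le_dblChain`, the Dini kernel `linear_of_diniRatio`, condensation, `DiniSeriesLaw`, `ohmicFloor_of_diniSeriesLaw`,
`boundedResponse_of_diniSeriesLaw` (11071 BY NAME), `diniSeriesLaw_of_bufferedSeriesLaw`, `diniSeriesLaw_of_bufferedJunctionLaw_of_exponentFloor`,
`seriesRatio_of_diniSeriesLaw`.
-/

noncomputable section

open MeasureTheory Filter Topology Set
open scoped BigOperators

namespace Summit.AtomisticToContinuum.FouriersLaw.Theorems.SubdiffusiveBondHeat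

namespace EscapeGrading

open Literature.MathematicalPhysics.KineticTheory.HeatConduction
open Summit.AtomisticToContinuum.FouriersLaw.Theses.BondHeatUncertainty (BoundedResponse NonBallistic)
open Summit.AtomisticToContinuum.FouriersLaw.Theorems.SubdiffusiveBondHeat.JunctionDefectGrading
  (EmbeddedBlockLawAt BufferPassivityAt LocalityPassivityLaw BufferedSeriesLaw BufferedJunctionLaw escapeDeficit_pos)

/-! ## A. The relative locality door -/

/-- **Relative embedded-block law (RELATIVE LOCALITY)** at `(ω₂, lam, β, γ, T)` with ratio `ρ` and buffer `L₀`: `∃ N₂, ∀ u v ≥ N₂`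
(`u, v ≥ 1`), `∀ ε > 0`, for all small `δ > 0` and every steady state `μ` of the `(u + L₀ + v)`-chain at `(T + δ/2, T − δ/2)`:
`(T + δ/2) − ⟨p_{u−1}²⟩_μ ≥ δ·(E_N·(ρ/E_u) − ε)` and `⟨p_{u+L₀}²⟩_μ − (T − δ/2) ≥ δ·(E_N·(ρ/E_v) − ε)` (`E = escapeDeficit … T`).
Ratio form (`j = γE_N·δ` to first order): the IN-SITU resistance `γ·drop/j` of each end block is at least `ρ` times its FREE resistance
`r_block = 1/E_block` — a bulk resistivity exists up to the factor `ρ`; contact corrections of any size `o(r_block)` are allowed (file 4's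
`EmbeddedBlockLawAt … c` allows only `O(1)`).  Calibration at the harmonic member (Rieder–Lebowitz–Lieb profile: flat bulk at the mean
temperature, each end block carries half the imposed difference, `E_N → e_∞ > 0`): TRUE for `ρ < 1/2`, FALSE for `ρ > 1/2` — the same
threshold as the ratio ladder `SeriesRatioLaw ρ`.  Tags: UNDECIDED · IDEA-NEEDED (no locality estimate for first-order NESS profiles of the
anharmonic pinned chain in tree or print) · INSTRUMENTABLE (profile fractions `φ(i) = (T_L − ⟨p_i²⟩)/δ`: `φ(u−1)·E_u/E_N ≥ ρ`,
`(1 − φ(u+L₀))·E_v/E_N ≥ ρ`) · WEAKER than `EmbeddedBlockLawAt … c L₀` for every `ρ < 1` once `1/E_n ≥ c/(1−ρ)` eventually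
(`relativeBlockLawAt_of_embeddedBlockLawAt`). [piece · relative locality] -/
def RelativeBlockLawAt (ω₂ lam β γ T ρ : ℝ) (L₀ : ℕ) : Prop :=
  ∃ N₂ : ℕ, ∀ u v : ℕ, N₂ ≤ u → N₂ ≤ v → ∀ (_hu : 1 ≤ u) (_hv : 1 ≤ v), ∀ ε : ℝ, 0 < ε →
    ∃ δ₀ : ℝ, 0 < δ₀ ∧ ∀ δ : ℝ, 0 < δ → δ < δ₀ →
      ∀ μ : Measure (PhaseSpace (u + L₀ + v)),
        (pinnedChain ω₂ lam β γ).IsSteadyState (u + L₀ + v) (T + δ / 2) (T - δ / 2) μ →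
          δ * (escapeDeficit ω₂ lam β γ T (u + L₀ + v) * (ρ / escapeDeficit ω₂ lam β γ T u) - ε)
              ≤ (T + δ / 2) - ∫ x, x.2 ⟨u - 1, by omega⟩ ^ 2 ∂μ ∧
          δ * (escapeDeficit ω₂ lam β γ T (u + L₀ + v) * (ρ / escapeDeficit ω₂ lam β γ T v) - ε)
              ≤ ∫ x, x.2 ⟨u + L₀, by omega⟩ ^ 2 ∂μ - (T - δ / 2)

/-- **The mixed ratio–junction inequality** at `(ω₂, lam, β, γ, T)`: `∃ N₂, ∀ u v ≥ N₂, ρ·(1/E_u + 1/E_v) − b ≤ 1/E_{u+L₀+v}` —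
relative slack `ρ` AND absolute budget `b`.  `b = 0` is the per-temperature instance of `SeriesRatioLaw ρ` (file 13); `ρ = 1` that of
`BufferedJunctionLaw` (file 5). [piece · per-temperature] -/
def RatioJunctionAt (ω₂ lam β γ T ρ b : ℝ) (L₀ : ℕ) : Prop :=
  ∃ N₂ : ℕ, ∀ u v : ℕ, N₂ ≤ u → N₂ ≤ v →
    ρ * (1 / escapeDeficit ω₂ lam β γ T u + 1 / escapeDeficit ω₂ lam β γ T v) - b
      ≤ 1 / escapeDeficit ω₂ lam β γ T (u + L₀ + v)

/-- **THE SEAM: relative locality + buffer passivity ⟹ the mixed inequality** `ρ·(1/E_u + 1/E_v) − b ≤ 1/E_{u+L₀+v}`.  At one small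
`δ > 0` and one steady state (which exists, `pinnedChain_exists_isSteadyState`) the three first-order drops telescope to `δ`:
`δ·(E_N·(ρ/E_u + ρ/E_v − b) − ε) ≤ δ`; let `ε → 0`, divide by `E_N > 0`. [this file] -/
theorem ratioJunctionAt_of_relativeProfileAt {ω₂ lam β γ T ρ b : ℝ} {L₀ : ℕ} (hω : 0 < ω₂) (hl : 0 < lam) (hβ : 0 < β)
    (hγ : 0 < γ) (hT : 0 < T) (hE : RelativeBlockLawAt ω₂ lam β γ T ρ L₀) (hB : BufferPassivityAt ω₂ lam β γ T b L₀) :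
    RatioJunctionAt ω₂ lam β γ T ρ b L₀ := by
  obtain ⟨N₂, hE⟩ := hE
  obtain ⟨N₂', hB⟩ := hB
  refine ⟨max (max N₂ N₂') 2, fun u v hu hv => ?_⟩
  have hu2 : 2 ≤ u := le_trans (le_max_right _ _) hu
  have hv2 : 2 ≤ v := le_trans (le_max_right _ _) hv
  have huN : N₂ ≤ u := le_trans (le_trans (le_max_left _ _) (le_max_left _ _)) hu
  have hvN : N₂ ≤ v := le_trans (le_trans (le_max_left _ _) (le_max_left _ _)) hv
  have huN' : N₂' ≤ u := le_trans (le_trans (le_max_right _ _) (le_max_left _ _)) hu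
  have hvN' : N₂' ≤ v := le_trans (le_trans (le_max_right _ _) (le_max_left _ _)) hv
  set EN := escapeDeficit ω₂ lam β γ T (u + L₀ + v) with hEN_def
  set Eu := escapeDeficit ω₂ lam β γ T u with hEu_def
  set Ev := escapeDeficit ω₂ lam β γ T v with hEv_def
  have hENpos : 0 < EN := escapeDeficit_pos hω hl hβ hγ hT (by omega)
  have key : EN * (ρ * (1 / Eu + 1 / Ev) - b) ≤ 1 := by
    refine le_of_forall_pos_le_add fun ε hε => ?_
    have hε3 : 0 < ε / 3 := by positivity
    obtain ⟨δ₁, hδ₁, h1⟩ := hE u v huN hvN (by omega) (by omega) (ε / 3) hε3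
    obtain ⟨δ₂, hδ₂, h2⟩ := hB u v huN' hvN' (by omega) (by omega) (ε / 3) hε3
    set δ : ℝ := min (min δ₁ δ₂) T / 2 with hδ_def
    have hm1 : min (min δ₁ δ₂) T ≤ δ₁ := (min_le_left _ _).trans (min_le_left _ _)
    have hm2 : min (min δ₁ δ₂) T ≤ δ₂ := (min_le_left _ _).trans (min_le_right _ _)
    have hmT : min (min δ₁ δ₂) T ≤ T := min_le_right _ _
    have hmpos : 0 < min (min δ₁ δ₂) T := lt_min (lt_min hδ₁ hδ₂) hT
    have hδpos : 0 < δ := by rw [hδ_def]; linarith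
    have hδlt1 : δ < δ₁ := by rw [hδ_def]; linarith
    have hδlt2 : δ < δ₂ := by rw [hδ_def]; linarith
    have hTL : 0 < T + δ / 2 := by linarith
    have hTR : 0 < T - δ / 2 := by rw [hδ_def]; linarith
    obtain ⟨μ, hμ⟩ := pinnedChain_exists_isSteadyState hω hl hβ hγ (u + L₀ + v) hTL hTR
    obtain ⟨hleft, hright⟩ := h1 δ hδpos hδlt1 μ hμ
    have hmid := h2 δ hδpos hδlt2 μ hμ
    have hsum : δ * (EN * (ρ * (1 / Eu + 1 / Ev) - b) - ε) ≤ δ := by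
      have hadd := add_le_add (add_le_add hleft hmid) hright
      have hlhs : δ * (EN * (ρ / Eu) - ε / 3) + -(δ * (b * EN + ε / 3)) + δ * (EN * (ρ / Ev) - ε / 3)
          = δ * (EN * (ρ * (1 / Eu + 1 / Ev) - b) - ε) := by ring
      have hrhs : (T + δ / 2 - ∫ x, x.2 ⟨u - 1, by omega⟩ ^ 2 ∂μ)
          + (∫ x, x.2 ⟨u - 1, by omega⟩ ^ 2 ∂μ - ∫ x, x.2 ⟨u + L₀, by omega⟩ ^ 2 ∂μ)
          + (∫ x, x.2 ⟨u + L₀, by omega⟩ ^ 2 ∂μ - (T - δ / 2)) = δ := by ring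
      linarith
    have hdiv : EN * (ρ * (1 / Eu + 1 / Ev) - b) - ε ≤ 1 := by
      by_contra hcon
      push Not at hcon
      have : δ * 1 < δ * (EN * (ρ * (1 / Eu + 1 / Ev) - b) - ε) := mul_lt_mul_of_pos_left hcon hδpos
      linarith
    linarith
  rw [le_div_iff₀ hENpos]
  calc (ρ * (1 / Eu + 1 / Ev) - b) * EN = EN * (ρ * (1 / Eu + 1 / Ev) - b) := by ring
    _ ≤ 1 := key

/-- Monotonicity of the mixed inequality: smaller slack and larger budget are weaker. [folklore] -/
theorem ratioJunctionAt_mono {ω₂ lam β γ T ρ ρ' b b' : ℝ} {L₀ : ℕ} (hω : 0 < ω₂) (hl : 0 < lam) (hβ : 0 < β) (hγ : 0 < γ)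
    (hT : 0 < T) (hρ : ρ' ≤ ρ) (hb : b ≤ b') (hJ : RatioJunctionAt ω₂ lam β γ T ρ b L₀) :
    RatioJunctionAt ω₂ lam β γ T ρ' b' L₀ := by
  obtain ⟨N₂, hJ⟩ := hJ
  refine ⟨max N₂ 2, fun u v hu hv => ?_⟩
  have h := hJ u v (le_trans (le_max_left _ _) hu) (le_trans (le_max_left _ _) hv)
  have hEu : 0 < escapeDeficit ω₂ lam β γ T u := escapeDeficit_pos hω hl hβ hγ hT (le_trans (le_max_right _ _) hu)
  have hEv : 0 < escapeDeficit ω₂ lam β γ T v := escapeDeficit_pos hω hl hβ hγ hT (le_trans (le_max_right _ _) hv)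
  have hsum : 0 ≤ 1 / escapeDeficit ω₂ lam β γ T u + 1 / escapeDeficit ω₂ lam β γ T v := by positivity
  nlinarith [mul_le_mul_of_nonneg_right hρ hsum]

/-- **Absorbing the budget: one good scale turns `(ρ, b)` into `(ρ', 0)` for every `ρ' < ρ`.**  If `E_n(T)` is not bounded away from
`0` (`liminf_N E_N(T) = 0`, the per-temperature instance of `EscapeInfZero` ≡ `NonBallistic` 9127), pick one scale `u⋆ ≥ N₂` with
`ρ·r_{u⋆} − b ≥ b/(ρ − ρ')`; then every `n ≥ u⋆ + L₀ + N₂` has `r_n ≥ ρ·r_{u⋆} − b`, so `(ρ − ρ')(r_u + r_v) ≥ b` beyond that scale and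
`ρ'·(r_u + r_v) ≤ ρ·(r_u + r_v) − b ≤ r_{u+L₀+v}`. [this file] -/
theorem ratioJunctionAt_absorb {ω₂ lam β γ T ρ ρ' b : ℝ} {L₀ : ℕ} (hω : 0 < ω₂) (hl : 0 < lam) (hβ : 0 < β) (hγ : 0 < γ)
    (hT : 0 < T) (hρ' : ρ' < ρ) (hJ : RatioJunctionAt ω₂ lam β γ T ρ b L₀)
    (hI : ∀ η : ℝ, 0 < η → ∀ M : ℕ, ∃ n : ℕ, M ≤ n ∧ escapeDeficit ω₂ lam β γ T n ≤ η) :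
    RatioJunctionAt ω₂ lam β γ T ρ' 0 L₀ := by
  rcases le_or_gt b 0 with hb | hb
  · exact ratioJunctionAt_mono hω hl hβ hγ hT hρ'.le hb hJ
  obtain ⟨N₂, hJ⟩ := hJ
  have hpos : ∀ n : ℕ, 2 ≤ n → 0 < escapeDeficit ω₂ lam β γ T n := fun n hn => escapeDeficit_pos hω hl hβ hγ hT hn
  rcases le_or_gt ρ 0 with hρ0 | hρ0
  · -- `ρ' < ρ ≤ 0`: the left-hand side is nonpositive
    refine ⟨2, fun u v hu hv => ?_⟩
    have hEu := hpos u hu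
    have hEv := hpos v hv
    have hEN := hpos (u + L₀ + v) (by omega)
    have hsum : 0 ≤ 1 / escapeDeficit ω₂ lam β γ T u + 1 / escapeDeficit ω₂ lam β γ T v := by positivity
    have : ρ' * (1 / escapeDeficit ω₂ lam β γ T u + 1 / escapeDeficit ω₂ lam β γ T v) ≤ 0 :=
      mul_nonpos_of_nonpos_of_nonneg (by linarith) hsum
    have : 0 ≤ 1 / escapeDeficit ω₂ lam β γ T (u + L₀ + v) := by positivity
    linarith
  -- the threshold resistance `R = b/(ρ − ρ')` and one good scale `u⋆`
  set R : ℝ := b / (ρ - ρ') with hR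
  have hRpos : 0 < R := div_pos hb (by linarith)
  obtain ⟨us, hus, hEus⟩ := hI (ρ / (R + b)) (by positivity) (max N₂ 2)
  have hus2 : 2 ≤ us := le_trans (le_max_right _ _) hus
  have husN : N₂ ≤ us := le_trans (le_max_left _ _) hus
  have hEus_pos := hpos us hus2
  have hrus : (R + b) / ρ ≤ 1 / escapeDeficit ω₂ lam β γ T us := by
    rw [div_le_div_iff₀ hρ0 hEus_pos, one_mul]
    calc (R + b) * escapeDeficit ω₂ lam β γ T us ≤ (R + b) * (ρ / (R + b)) :=
          mul_le_mul_of_nonneg_left hEus (by positivity)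
      _ = ρ := by field_simp
  -- every scale beyond `u⋆ + L₀ + N₂` has resistance at least `R`
  have hfloor : ∀ n : ℕ, us + L₀ + max N₂ 2 ≤ n → R ≤ 1 / escapeDeficit ω₂ lam β γ T n := by
    intro n hn
    have hm : max N₂ 2 ≤ n - (us + L₀) := by omega
    have hsplit : us + L₀ + (n - (us + L₀)) = n := by omega
    have h := hJ us (n - (us + L₀)) husN (le_trans (le_max_left _ _) hm)
    rw [hsplit] at h
    have hrm : 0 ≤ 1 / escapeDeficit ω₂ lam β γ T (n - (us + L₀)) :=
      (one_div_pos.2 (hpos _ (le_trans (le_max_right _ _) hm))).le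
    have h1 : R ≤ ρ * ((R + b) / ρ) - b := by
      rw [mul_div_cancel₀ _ (ne_of_gt hρ0)]
      linarith
    nlinarith [mul_le_mul_of_nonneg_left hrus hρ0.le]
  refine ⟨us + L₀ + max N₂ 2, fun u v hu hv => ?_⟩
  have huN : N₂ ≤ u := by have := le_max_left N₂ 2; omega
  have hvN : N₂ ≤ v := by have := le_max_left N₂ 2; omega
  have h := hJ u v huN hvN
  have hRu := hfloor u hu
  have hRv := hfloor v hv
  -- `(ρ − ρ')·(r_u + r_v) ≥ (ρ − ρ')·2R = 2b ≥ b`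
  have hgap : b ≤ (ρ - ρ') * (1 / escapeDeficit ω₂ lam β γ T u + 1 / escapeDeficit ω₂ lam β γ T v) := by
    have hne : ρ - ρ' ≠ 0 := ne_of_gt (by linarith)
    have h2 : (ρ - ρ') * R = b := by
      rw [hR]
      field_simp
    nlinarith
  linarith

/-- Smaller ratio = WEAKER relative locality (`E_N ≥ 0`, `1/E_u > 0` for `u ≥ 2`). [folklore] -/
theorem relativeBlockLawAt_anti {ω₂ lam β γ T ρ ρ' : ℝ} {L₀ : ℕ} (hω : 0 < ω₂) (hl : 0 < lam) (hβ : 0 < β) (hγ : 0 < γ)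
    (hT : 0 < T) (hρρ' : ρ ≤ ρ') (h : RelativeBlockLawAt ω₂ lam β γ T ρ' L₀) : RelativeBlockLawAt ω₂ lam β γ T ρ L₀ := by
  obtain ⟨N₂, h⟩ := h
  refine ⟨max N₂ 2, fun u v hu hv hu1 hv1 ε hε => ?_⟩
  obtain ⟨δ₀, hδ₀, h'⟩ := h u v (le_trans (le_max_left _ _) hu) (le_trans (le_max_left _ _) hv) hu1 hv1 ε hε
  refine ⟨δ₀, hδ₀, fun δ hδ hδδ₀ μ hμ => ?_⟩
  obtain ⟨hleft, hright⟩ := h' δ hδ hδδ₀ μ hμ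
  have hEN : 0 ≤ escapeDeficit ω₂ lam β γ T (u + L₀ + v) :=
    (escapeDeficit_pos hω hl hβ hγ hT (by have := le_trans (le_max_right N₂ 2) hu; omega)).le
  have hEu : 0 < escapeDeficit ω₂ lam β γ T u := escapeDeficit_pos hω hl hβ hγ hT (le_trans (le_max_right _ _) hu)
  have hEv : 0 < escapeDeficit ω₂ lam β γ T v := escapeDeficit_pos hω hl hβ hγ hT (le_trans (le_max_right _ _) hv)
  have hmu : ρ / escapeDeficit ω₂ lam β γ T u ≤ ρ' / escapeDeficit ω₂ lam β γ T u :=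
    div_le_div_of_nonneg_right hρρ' hEu.le
  have hmv : ρ / escapeDeficit ω₂ lam β γ T v ≤ ρ' / escapeDeficit ω₂ lam β γ T v :=
    div_le_div_of_nonneg_right hρρ' hEv.le
  constructor
  · refine le_trans ?_ hleft
    apply mul_le_mul_of_nonneg_left _ hδ.le
    linarith [mul_le_mul_of_nonneg_left hmu hEN]
  · refine le_trans ?_ hright
    apply mul_le_mul_of_nonneg_left _ hδ.le
    linarith [mul_le_mul_of_nonneg_left hmv hEN]

/-- **Relative locality is WEAKER than file 4's absolute locality** for every `ρ < 1`, once the free resistance exceeds `c/(1−ρ)`: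
`E_N·(1/E_u − c) ≥ E_N·(ρ/E_u)` iff `(1−ρ)/E_u ≥ c`. [this file] -/
theorem relativeBlockLawAt_of_embeddedBlockLawAt {ω₂ lam β γ T c ρ : ℝ} {L₀ : ℕ} (hω : 0 < ω₂) (hl : 0 < lam) (hβ : 0 < β)
    (hγ : 0 < γ) (hT : 0 < T) (hρ : ρ < 1) (hE : EmbeddedBlockLawAt ω₂ lam β γ T c L₀)
    (hgrow : ∃ N₃ : ℕ, ∀ n : ℕ, N₃ ≤ n → c / (1 - ρ) ≤ 1 / escapeDeficit ω₂ lam β γ T n) :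
    RelativeBlockLawAt ω₂ lam β γ T ρ L₀ := by
  obtain ⟨N₂, hE⟩ := hE
  obtain ⟨N₃, hgrow⟩ := hgrow
  refine ⟨max (max N₂ N₃) 2, fun u v hu hv hu1 hv1 ε hε => ?_⟩
  have huN : N₂ ≤ u := le_trans (le_trans (le_max_left _ _) (le_max_left _ _)) hu
  have hvN : N₂ ≤ v := le_trans (le_trans (le_max_left _ _) (le_max_left _ _)) hv
  have huN₃ : N₃ ≤ u := le_trans (le_trans (le_max_right _ _) (le_max_left _ _)) hu
  have hvN₃ : N₃ ≤ v := le_trans (le_trans (le_max_right _ _) (le_max_left _ _)) hv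
  obtain ⟨δ₀, hδ₀, h'⟩ := hE u v huN hvN hu1 hv1 ε hε
  refine ⟨δ₀, hδ₀, fun δ hδ hδδ₀ μ hμ => ?_⟩
  obtain ⟨hleft, hright⟩ := h' δ hδ hδδ₀ μ hμ
  have hEN : 0 ≤ escapeDeficit ω₂ lam β γ T (u + L₀ + v) :=
    (escapeDeficit_pos hω hl hβ hγ hT (by have := le_trans (le_max_right (max N₂ N₃) 2) hu; omega)).le
  have h1ρ : 0 < 1 - ρ := by linarith
  -- `ρ/E ≤ 1/E − c` from `c/(1−ρ) ≤ 1/E`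
  have hcmp : ∀ n : ℕ, N₃ ≤ n → ρ / escapeDeficit ω₂ lam β γ T n ≤ 1 / escapeDeficit ω₂ lam β γ T n - c := by
    intro n hn
    have hg := hgrow n hn
    rw [div_le_iff₀ h1ρ] at hg
    have : ρ / escapeDeficit ω₂ lam β γ T n = ρ * (1 / escapeDeficit ω₂ lam β γ T n) := by ring
    rw [this]
    nlinarith
  constructor
  · refine le_trans ?_ hleft
    apply mul_le_mul_of_nonneg_left _ hδ.le
    linarith [mul_le_mul_of_nonneg_left (hcmp u huN₃) hEN]
  · refine le_trans ?_ hright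
    apply mul_le_mul_of_nonneg_left _ hδ.le
    linarith [mul_le_mul_of_nonneg_left (hcmp v hvN₃) hEN]

/-- **Relative locality law with ratio `ρ`** (global): for all parameters and `T > 0` there are a back-flow budget `b` and a buffer `L₀` with
`RelativeBlockLawAt … ρ L₀` (relative locality of the two end blocks) and file 5's `BufferPassivityAt … b L₀` (first-order kinetic
temperature rises by at most `b·j/γ` across the buffer — the SOFT piece, expected for every member incl. the harmonic one).  The relative
reading of file 5's `LocalityPassivityLaw` (which is the absolute case: `localityPassivityLaw` ∧ `EscapeVanishing` ⟹ this, every `ρ < 1`).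
DOOR INTO `AsymptoticSeriesLaw`: `(∀ ρ < 1, RelativeLocalityLaw ρ) ∧ EscapeInfZero ⟹ AsymptoticSeriesLaw`
(`asymptoticSeries_of_relativeLocality_of_escapeInfZero`; `EscapeInfZero ⟺ NonBallistic` 9127, itself implied by `AsymptoticSeriesLaw`).
Tags: UNDECIDED · IDEA-NEEDED (relative locality of first-order NESS profiles) · INSTRUMENTABLE (profile fractions) · NOT on the 11071 side
(consistent with `r_N = N/log N`: carries no absolute control) · phonon-calibrated (harmonic analogue true iff `ρ ≤ 1/2`). [piece · door] -/
def RelativeLocalityLaw (ρ : ℝ) : Prop :=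
  ∀ ω₂ lam β γ : ℝ, 0 < ω₂ → 0 < lam → 0 < β → 0 < γ → ∀ T : ℝ, 0 < T →
    ∃ b : ℝ, ∃ L₀ : ℕ, RelativeBlockLawAt ω₂ lam β γ T ρ L₀ ∧ BufferPassivityAt ω₂ lam β γ T b L₀

/-- Smaller ratio = WEAKER law. [folklore] -/
theorem relativeLocalityLaw_anti {ρ ρ' : ℝ} (hρρ' : ρ ≤ ρ') : RelativeLocalityLaw ρ' → RelativeLocalityLaw ρ := by
  intro h ω₂ lam β γ hω hl hβ hγ T hT
  obtain ⟨b, L₀, hE, hB⟩ := h ω₂ lam β γ hω hl hβ hγ T hT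
  exact ⟨b, L₀, relativeBlockLawAt_anti hω hl hβ hγ hT hρρ' hE, hB⟩

/-- **`LocalityPassivityLaw ∧ EscapeVanishing ⟹ RelativeLocalityLaw ρ` for every `ρ < 1`** — the relative door is WEAKER than file 5's
absolute door together with `EscapeVanishing` (≡ 28286, which `AsymptoticSeriesLaw` implies). [this file] -/
theorem relativeLocalityLaw_of_localityPassivityLaw_of_escapeVanishing {ρ : ℝ} (hρ : ρ < 1) (hL : LocalityPassivityLaw)
    (hV : EscapeVanishing) : RelativeLocalityLaw ρ := by
  intro ω₂ lam β γ hω hl hβ hγ T hT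
  obtain ⟨c, b, L₀, hE, hB⟩ := hL ω₂ lam β γ hω hl hβ hγ T hT
  refine ⟨b, L₀, relativeBlockLawAt_of_embeddedBlockLawAt hω hl hβ hγ hT hρ hE ?_, hB⟩
  have h1ρ : 0 < 1 - ρ := by linarith
  rcases le_or_gt c 0 with hc | hc
  · refine ⟨2, fun n hn => le_trans (div_nonpos_of_nonpos_of_nonneg hc h1ρ.le) ?_⟩
    exact (one_div_pos.2 (escapeDeficit_pos hω hl hβ hγ hT hn)).le
  · have hη : 0 < (1 - ρ) / c := by positivity
    obtain ⟨N₁, hN₁⟩ := eventually_atTop.1 ((hV ω₂ lam β γ hω hl hβ hγ T hT).eventually (Iic_mem_nhds hη))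
    refine ⟨max N₁ 2, fun n hn => ?_⟩
    have hEn : 0 < escapeDeficit ω₂ lam β γ T n := escapeDeficit_pos hω hl hβ hγ hT (le_trans (le_max_right _ _) hn)
    have hsmall : escapeDeficit ω₂ lam β γ T n ≤ (1 - ρ) / c := hN₁ n (le_trans (le_max_left _ _) hn)
    rw [div_le_div_iff₀ h1ρ hEn, one_mul]
    calc c * escapeDeficit ω₂ lam β γ T n ≤ c * ((1 - ρ) / c) := mul_le_mul_of_nonneg_left hsmall hc.le
      _ = 1 - ρ := by field_simp

/-- **THE DOOR, per rung: `RelativeLocalityLaw ρ ∧ EscapeInfZero ⟹ SeriesRatioLaw ρ'` for every `ρ' < ρ`** (conclusion displayed in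
the unfolded form of file 13's `SeriesRatioLaw ρ'`). [this file · frame] -/
theorem seriesRatio_of_relativeLocalityLaw_of_escapeInfZero {ρ ρ' : ℝ} (hρ' : ρ' < ρ) (hL : RelativeLocalityLaw ρ)
    (hI : EscapeInfZero) :
    ∀ ω₂ lam β γ : ℝ, 0 < ω₂ → 0 < lam → 0 < β → 0 < γ → ∀ T : ℝ, 0 < T →
      ∃ L₀ N₂ : ℕ, ∀ u v : ℕ, N₂ ≤ u → N₂ ≤ v →
        ρ' * (1 / escapeDeficit ω₂ lam β γ T u + 1 / escapeDeficit ω₂ lam β γ T v)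
          ≤ 1 / escapeDeficit ω₂ lam β γ T (u + L₀ + v) := by
  intro ω₂ lam β γ hω hl hβ hγ T hT
  obtain ⟨b, L₀, hE, hB⟩ := hL ω₂ lam β γ hω hl hβ hγ T hT
  have hJ := ratioJunctionAt_of_relativeProfileAt hω hl hβ hγ hT hE hB
  obtain ⟨N₂, h⟩ := ratioJunctionAt_absorb hω hl hβ hγ hT hρ' hJ (hI ω₂ lam β γ hω hl hβ hγ T hT)
  exact ⟨L₀, N₂, fun u v hu hv => by simpa using h u v hu hv⟩

/-- **THE DOOR INTO `AsymptoticSeriesLaw`: `(∀ ρ < 1, RelativeLocalityLaw ρ) ∧ EscapeInfZero ⟹ ∀ ρ' < 1, SeriesRatioLaw ρ'`**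
(= `AsymptoticSeriesLaw`, unfolded; take `ρ = (1 + ρ')/2`). [this file · frame] -/
theorem asymptoticSeries_of_relativeLocality_of_escapeInfZero (hL : ∀ ρ : ℝ, ρ < 1 → RelativeLocalityLaw ρ)
    (hI : EscapeInfZero) :
    ∀ ρ' : ℝ, ρ' < 1 → ∀ ω₂ lam β γ : ℝ, 0 < ω₂ → 0 < lam → 0 < β → 0 < γ → ∀ T : ℝ, 0 < T →
      ∃ L₀ N₂ : ℕ, ∀ u v : ℕ, N₂ ≤ u → N₂ ≤ v →
        ρ' * (1 / escapeDeficit ω₂ lam β γ T u + 1 / escapeDeficit ω₂ lam β γ T v)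
          ≤ 1 / escapeDeficit ω₂ lam β γ T (u + L₀ + v) := fun ρ' hρ' =>
  seriesRatio_of_relativeLocalityLaw_of_escapeInfZero (ρ := (1 + ρ') / 2) (by linarith) (hL _ (by linarith)) hI

/-- The same door with the partner named as the route item `NonBallistic` (stmt-9127; `escapeInfZero_iff_nonBallistic`, file 8).
[this file · frame] -/
theorem asymptoticSeries_of_relativeLocality_of_nonBallistic (hL : ∀ ρ : ℝ, ρ < 1 → RelativeLocalityLaw ρ)
    (hN : NonBallistic) :
    ∀ ρ' : ℝ, ρ' < 1 → ∀ ω₂ lam β γ : ℝ, 0 < ω₂ → 0 < lam → 0 < β → 0 < γ → ∀ T : ℝ, 0 < T →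
      ∃ L₀ N₂ : ℕ, ∀ u v : ℕ, N₂ ≤ u → N₂ ≤ v →
        ρ' * (1 / escapeDeficit ω₂ lam β γ T u + 1 / escapeDeficit ω₂ lam β γ T v)
          ≤ 1 / escapeDeficit ω₂ lam β γ T (u + L₀ + v) :=
  asymptoticSeries_of_relativeLocality_of_escapeInfZero hL (escapeInfZero_iff_nonBallistic.2 hN)

end EscapeGrading

end Summit.AtomisticToContinuum.FouriersLaw.Theorems.SubdiffusiveBondHeat

end
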